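/-
HarnessLib.Audit.CarrierProbe — CARRIER INHABITEDNESS / VACUITY probe (D-0034 t-carrier; coordinator 2026-08-17 after the FinalStateConjecture
finding: 318 items were typed over `VacuumDevelopment`, a carrier with no inhabitant, so every `∀ D : VacuumDevelopment …` item was vacuously true).
Two entry points:
* `#h21_carrier_probe C₁ C₂ …` — per CONSTANT `C : ∀ params, Sort u` (structure / def / inductive): probe `∀ params, Nonempty (C params)` and
  `∀ params, IsEmpty (C params)` (plus `∀ params, C params → False`), and when inhabited also `∀ params, Subsingleton (C params)` (TRIVIAL carrier);
  one `H21_CARRIER_JSON {…}` line per constant. Used by the fleet-wide census (harness/kit/carrier_census.py).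
* `probeStatementCarriers env cfg stmt` (API for `#h21_tribunal`'s t-carrier clause): for every DATA binder of a crux statement's telescope whose
  domain is headed by a project type, probe the domain IN CONTEXT (`∀ earlier binders it needs, Nonempty dom` / `IsEmpty dom`).
Imports Lean + HarnessLib.Audit.CruxProbe (telescope, mkGoal, tryTacticOn, isProjectConst); no Mathlib (tactics parsed at run time). Never throws.
Imported by nothing in the tree except HarnessLib.Audit.Tribunal.
-/
import Lean
import HarnessLib.Audit.Tags
import HarnessLib.Audit.CruxProbe

open Lean Meta Elab Command
open HarnessLib.Audit HarnessLib.Audit.CruxProbe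

namespace HarnessLib.Audit.CarrierProbe

/-- Budget knobs (read by name so an inlined copy works). -/
structure Cfg where
  cheapHeartbeats : Nat := 40000
  heartbeats : Nat := 200000
  goalMs : Nat := 5000
  totalMs : Nat := 120000
  librarySearch : Bool := false
  maxCarriers : Nat := 24
  deriving Inhabited, Repr

def Cfg.ofOptions (o : Options) : Cfg :=
  let d : Cfg := {}
  { cheapHeartbeats := o.get `h21.carrierProbe.cheapHeartbeats d.cheapHeartbeats, heartbeats := o.get `h21.carrierProbe.heartbeats d.heartbeats,
    goalMs := o.get `h21.carrierProbe.goalMs d.goalMs, totalMs := o.get `h21.carrierProbe.totalMs d.totalMs,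
    librarySearch := o.get `h21.carrierProbe.librarySearch d.librarySearch, maxCarriers := o.get `h21.carrierProbe.maxCarriers d.maxCarriers }

register_option h21.carrierProbe.cheapHeartbeats : Nat := { defValue := 40000, descr := "#h21_carrier_probe: maxHeartbeats (×1000) per ordinary attempt" }
register_option h21.carrierProbe.heartbeats : Nat := { defValue := 200000, descr := "#h21_carrier_probe: maxHeartbeats (×1000) per exact? attempt" }
register_option h21.carrierProbe.goalMs : Nat := { defValue := 5000, descr := "#h21_carrier_probe: wall budget per goal (ms)" }
register_option h21.carrierProbe.totalMs : Nat := { defValue := 120000, descr := "#h21_carrier_probe: wall budget per command (ms)" }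
register_option h21.carrierProbe.librarySearch : Bool := { defValue := false, descr := "#h21_carrier_probe: allow `exact?` (full tier)" }
register_option h21.carrierProbe.maxCarriers : Nat := { defValue := 24, descr := "#h21_carrier_probe: cap on binder domains probed per statement" }

/-- Inhabitedness portfolio (goal `… ⊢ Nonempty T`). -/
def inhTactics (ls : Bool) : Array String :=
  #["intros; infer_instance", "intros; exact ⟨default⟩", "intros; exact ⟨0⟩", "intros; exact ⟨fun _ => default⟩", "intros; exact ⟨∅⟩",
    "intros; refine ⟨?_⟩; constructor", "intros; refine ⟨?_⟩; constructor <;> first | exact default | infer_instance | exact 0 | exact fun _ => default | simp | decide",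
    "intros; refine ⟨?_⟩; constructor <;> aesop", "intros; constructor; aesop"] ++ (if ls then #["intros; refine ⟨?_⟩; exact?", "intros; exact?"] else #[])
/-- Emptiness portfolio (goal `… ⊢ IsEmpty T` or `… ⊢ T → False`). -/
def emptyTactics (ls : Bool) : Array String :=
  #["intros; infer_instance", "intros; constructor; intro x; cases x; simp_all", "intros; constructor; intro x; rcases x; omega",
    "intros; refine ⟨fun x => ?_⟩; obtain ⟨⟩ := x", "intros; constructor; intro x; cases x; aesop", "intros; constructor; intro x; have := x.2; simp_all",
    "intros; constructor; intro x; rcases x with ⟨⟩; subst_vars; first | omega | simp_all | (exact Fin.elim0 ‹_›) | aesop",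
    "intro x; cases x; simp_all", "intro x; rcases x; omega", "intro x; cases x; aesop", "intros; intro x; rcases x with ⟨⟩; subst_vars; first | omega | simp_all | (exact Fin.elim0 ‹_›) | aesop"] ++ (if ls then #["intros; exact?"] else #[])
/-- Triviality portfolio (goal `… ⊢ Subsingleton T`). -/
def trivTactics : Array String :=
  #["intros; infer_instance", "intros; constructor; intro a b; cases a; cases b; simp_all", "intros; constructor; intro a b; rfl", "intros; constructor; aesop"]

structure Row where
  carrier : String          -- constant name or binder label
  shown : String            -- pretty type
  status : String := "unknown"   -- inhabited | empty | unknown | error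
  by_ : String := ""
  witness : String := ""    -- pp of the closing term (trunc)
  trivial : Bool := false   -- Subsingleton proved (only when inhabited)
  trivialBy : String := ""
  attempts : Nat := 0
  ms : Nat := 0
  note : String := ""
  deriving Inhabited

def Row.toJson (r : Row) : Json :=
  Json.mkObj [("carrier", r.carrier), ("shown", r.shown), ("status", r.status), ("by", r.by_), ("witness", r.witness), ("trivial", r.trivial),
    ("trivial_by", r.trivialBy), ("attempts", r.attempts), ("ms", r.ms), ("note", r.note)]

private def ppT (e : Expr) (n : Nat := 200) : MetaM String := do
  let f ← try ppExpr e catch _ => pure (format (toString e))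
  return trunc (f.pretty 120) n

/-- Run a portfolio on one closed goal; first clean closer wins. Returns (closed?, tactic, witness pp, attempts). Proofs whose axiom closure leaves the
whitelist (sorryAx, ofReduceBool …) do not count. -/
def runPortfolio (goal : Expr) (tacs : Array String) (cfg : Cfg) (deadline : Nat) : TermElabM (Bool × String × String × Nat) := do
  let mut n := 0
  for tac in tacs do
    if (← IO.monoMsNow) > deadline then break
    let isLS := (tac.splitOn "exact?").length > 1
    if isLS && !cfg.librarySearch then continue
    n := n + 1
    -- run in an EMPTY local context: the goals are closed terms, and an ambient telescope fvar `v : T` must not witness `Nonempty T`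
    let r ← if goal.hasFVar then pure (TacOutcome.failed "goal has free variables") else withLCtx {} #[] (tryTacticOn goal tac (if isLS then cfg.heartbeats else cfg.cheapHeartbeats))
    match r with
    | .closed pf =>
      -- the axiom closure of every constant the proof uses must stay inside the whitelist (no sorryAx, no ofReduceBool …)
      let mut ok := !(pf.getUsedConstants.contains ``sorryAx)
      if ok then
        for c in pf.getUsedConstants do
          let axs ← Lean.collectAxioms c
          if axs.any (fun a => !([``propext, ``Classical.choice, ``Quot.sound].contains a)) then ok := false
      unless ok do continue
      return (true, tac, (← ppT pf 160), n)
    | _ => pure ()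
  return (false, "", "", n)

/-- Probe one carrier given the three CLOSED goals. -/
def probeGoals (label shown : String) (gNonempty gIsEmpty : Expr) (gToFalse gSubsing : Option Expr) (cfg : Cfg) (deadline : Nat) : TermElabM Row := do
  let t0 ← IO.monoMsNow
  let goalDl := fun (_ : Unit) => do return min ((← IO.monoMsNow) + cfg.goalMs) deadline
  let mut row : Row := { carrier := label, shown }
  let (inh, tac, w, n1) ← runPortfolio gNonempty (inhTactics cfg.librarySearch) cfg (← goalDl ())
  row := { row with attempts := n1 }
  if inh then
    row := { row with status := "inhabited", by_ := tac, witness := w }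
    if let some gs := gSubsing then
      let (tr, ttac, _, n3) ← runPortfolio gs trivTactics cfg (← goalDl ())
      row := { row with trivial := tr, trivialBy := ttac, attempts := row.attempts + n3 }
  else
    let (emp, etac, w2, n2) ← runPortfolio gIsEmpty (emptyTactics cfg.librarySearch) cfg (← goalDl ())
    row := { row with attempts := row.attempts + n2 }
    if emp then
      row := { row with status := "empty", by_ := etac, witness := w2 }
    else if let some gf := gToFalse then
      let (emp2, etac2, w3, n4) ← runPortfolio gf (emptyTactics cfg.librarySearch) cfg (← goalDl ())
      row := { row with attempts := row.attempts + n4 }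
      if emp2 then row := { row with status := "empty", by_ := etac2 ++ " (T → False)", witness := w3 }
  return { row with ms := (← IO.monoMsNow) - t0 }

/-- Constant-level probe: `C : ∀ params, Sort u`. Goals `∀ params, Nonempty (C params)` etc. -/
def probeConstant (c : Name) (cfg : Cfg) (deadline : Nat) : TermElabM Row := do
  let env ← getEnv
  let some ci := env.find? c | return { carrier := c.toString, shown := "", status := "error", note := "unknown constant" }
  let ty := ci.type
  let lv := ci.levelParams.map Level.param
  try
    forallTelescope ty fun ps body => do
      let body ← whnf body
      unless body.isSort do
        return { carrier := c.toString, shown := (← ppT ty), status := "error", note := "not a type former (does not end in Sort)" }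
      let app := mkAppN (mkConst c lv) ps
      let appTy ← inferType app
      -- `Nonempty`/`IsEmpty`/`Subsingleton` need `Sort u`; Prop-valued carriers (u = 0) are statements, not carriers
      if appTy.isProp then
        return { carrier := c.toString, shown := (← ppT ty), status := "error", note := "Prop-valued (a statement, not a carrier)" }
      let gN ← mkForallFVars ps (← mkAppM ``Nonempty #[app])
      let gF ← mkForallFVars ps (← mkArrow app (mkConst ``False))
      let gE ← if env.contains `IsEmpty then (try (do let e ← mkAppM `IsEmpty #[app]; mkForallFVars ps e) catch _ => pure gF) else pure gF
      let gS ← mkForallFVars ps (← mkAppM ``Subsingleton #[app])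
      probeGoals c.toString (← ppT ty 160) gN gE (some gF) (some gS) cfg deadline
  catch e =>
    return { carrier := c.toString, shown := "", status := "error", note := trunc (← e.toMessageData.toString) 200 }

/-- Statement-level probe (t-carrier): every data binder of the telescope whose domain is headed by a PROJECT constant (or whose domain mentions one),
in context: goal `∀ (the earlier binders the domain depends on), Nonempty dom`. Returns rows labelled `binder:<name>`. -/
def probeStatementCarriers (env : Environment) (cfg : Cfg) (stmt : Expr) (deadline : Nat) : TermElabM (Array Row) := do
  let ccfg : CruxProbe.Cfg := {}
  openTelescope env true ccfg.unfoldDepth stmt fun fvs _g _opened => do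
    let mut xs : Array Binder := #[]
    for x in fvs do
      let ld ← x.fvarId!.getDecl
      let ty ← instantiateMVars ld.type
      let isP ← isProp ty
      xs := xs.push { fvar := x, name := ld.userName.eraseMacroScopes, isProp := isP, isInst := ld.binderInfo.isInstImplicit, type := ty, probeType := ty,
                      shown := s!"({ld.userName.eraseMacroScopes} : {← ppT ty 100})" }
    let mut rows : Array Row := #[]
    let mut seen : Std.HashSet String := {}
    for i in [0:xs.size] do
      if rows.size ≥ cfg.maxCarriers then break
      if (← IO.monoMsNow) > deadline then break
      let b := xs[i]!
      if b.isProp || b.isInst then continue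
      let dom ← whnfR b.type
      if dom.isSort then continue                     -- a type parameter, not a carrier
      let heads := dom.getUsedConstants.filter fun c => isProjectConst env c
      if heads.isEmpty then continue                  -- Mathlib / core carrier: trusted inhabited-or-known
      let key := toString (← ppT dom 300)
      if seen.contains key then continue
      seen := seen.insert key
      -- keep the earlier binders the domain depends on (+ instance binders among them)
      let need ← depClosure xs dom
      let keep := xs.mapIdx fun j c => j < i && (need.contains c.fvar.fvarId! || (c.isInst && ((collectFVars {} c.type).fvarIds.any need.contains)))
      let gN? ← mkGoal xs keep (← mkAppM ``Nonempty #[dom])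
      let gF? ← mkGoal xs keep (← mkArrow dom (mkConst ``False))
      let gE? ← if env.contains `IsEmpty then (try (do let e ← mkAppM `IsEmpty #[dom]; mkGoal xs keep e) catch _ => pure gF?) else pure gF?
      let gS? ← mkGoal xs keep (← mkAppM ``Subsingleton #[dom])
      match gN?, gE? with
      | some gN, some gE =>
        let r ← probeGoals s!"binder:{b.name}" key gN gE gF? gS? cfg deadline
        rows := rows.push { r with note := s!"heads {(heads.toList.take 3)}" }
      | _, _ => rows := rows.push { carrier := s!"binder:{b.name}", shown := key, status := "error", note := "could not close the goal over earlier binders" }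
    return rows

def marker : String := "H21_CARRIER_JSON"

/-- `#h21_carrier_probe C₁ C₂ …` — constant-level census probe; one `H21_CARRIER_JSON` line per constant (never throws).
`#h21_carrier_probe_stmt D` — probes the binder domains of the Prop definition `D` in context (the t-carrier view). -/
syntax (name := h21CarrierProbe) "#h21_carrier_probe " (ppSpace ident)+ : command
syntax (name := h21CarrierProbeStmt) "#h21_carrier_probe_stmt " ident : command

def runCarrierProbe (ids : Array Name) (stmt? : Option Name) : CommandElabM Unit := do
  let cfg := Cfg.ofOptions (← getOptions)
  let saved := (← get).messages
  let t0 ← IO.monoMsNow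
  let deadline := t0 + cfg.totalMs
  let mut lines : Array String := #[]
  let mut jsons : Array Json := #[]
  for raw in ids do
    let c ← resolveName raw
    let row ← try
        liftTermElabM <| withTheReader Core.Context (fun ctx => { ctx with maxHeartbeats := 0 }) (probeConstant c cfg deadline)
      catch e => pure { carrier := c.toString, shown := "", status := "error", note := trunc (← e.toMessageData.toString) 200 }
    lines := lines.push s!"{row.carrier}: {row.status} {row.by_} {if row.trivial then "[TRIVIAL: Subsingleton]" else ""} {row.ms}ms {row.note}"
    jsons := jsons.push (Json.mkObj [("h21_carrier_probe", c.toString), ("kind", "constant"), ("row", row.toJson), ("v", (1 : Nat))])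
  if let some sraw := stmt? then
    let d ← resolveName sraw
    let res : Except String (Array Row) ← try
        liftTermElabM <| withTheReader Core.Context (fun ctx => { ctx with maxHeartbeats := 0 }) (do
          let env ← getEnv
          match ← cruxStatement env d with
          | .error why => return (Except.error why : Except String (Array Row))
          | .ok (stmt, _) => return Except.ok (← probeStatementCarriers env cfg stmt deadline))
      catch e => pure (Except.error (trunc (← e.toMessageData.toString) 200))
    match res with
    | .error why =>
      lines := lines.push s!"statement {d}: ERROR {why}"
      jsons := jsons.push (Json.mkObj [("h21_carrier_probe", d.toString), ("kind", "statement"), ("error", why), ("rows", Json.arr #[]), ("v", (1 : Nat))])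
    | .ok rows =>
      for r in rows do lines := lines.push s!"  {r.carrier} {r.shown}: {r.status} {r.by_} {if r.trivial then "[TRIVIAL]" else ""} {r.ms}ms"
      let empties := (rows.filter (·.status == "empty")).map (·.carrier)
      jsons := jsons.push (Json.mkObj [("h21_carrier_probe", d.toString), ("kind", "statement"), ("rows", Json.arr (rows.map Row.toJson)),
        ("empty", Json.arr (empties.map Json.str)), ("unknown", Json.arr (((rows.filter (·.status == "unknown")).map (·.carrier)).map Json.str)),
        ("trivial", Json.arr (((rows.filter (·.trivial)).map (·.carrier)).map Json.str)), ("v", (1 : Nat))])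
  modify fun s => { s with messages := saved }
  logInfo ("\n".intercalate lines.toList ++ "\n" ++ "\n".intercalate (jsons.map fun j => marker ++ " " ++ j.compress).toList)

@[command_elab h21CarrierProbe] def elabH21CarrierProbe : CommandElab := fun stx =>
  runCarrierProbe (stx[1].getArgs.map fun s => s.getId.replacePrefix `_root_ .anonymous) none

@[command_elab h21CarrierProbeStmt] def elabH21CarrierProbeStmt : CommandElab := fun stx =>
  runCarrierProbe #[] (some (stx[1].getId.replacePrefix `_root_ .anonymous))

end HarnessLib.Audit.CarrierProbe
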